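import Literature.MathematicalPhysics.QuantumFieldTheory.Balaban1983to89.B8LeafKnitZd3E
import Literature.MathematicalPhysics.QuantumFieldTheory.Balaban1983to89.B8Prop6CubeMemberGauged
import Literature.MathematicalPhysics.QuantumFieldTheory.Balaban1983to89.B8LeafKnitZd3LettersRD
import Literature.MathematicalPhysics.QuantumFieldTheory.Balaban1983to89.B8SockHFPCubeMemberRD

/-!
# `Balaban1983to89.B8LeafKnitZd3Cub` — [Balaban1985RegularSpaces] THE N05 KNIT WITH PROPOSITION 6 (p. 99) DISCHARGED AT THE CONCRETE
# CUBE FAMILY {□_j} OF (1.131): the `p6` binder of n05-a's ι-generic knit faces replaced by the Theorem-4 ∕ Proposition-3 SOCKETS AT EVERY CUBE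

statement-level skeleton of published theorems with citation tags; proofs where landed; nothing here is a claim about the
Yang–Mills mass gap

T. Bałaban, *Spaces of regular gauge field configurations on a lattice and gauge fixing conditions*, Commun. Math. Phys. **99**
(1985) 75–102 `[Balaban1985RegularSpaces]` ("B8"), Sect. F pp. 98–99 (Proposition 6, (1.131)–(1.138)), Theorem 4 p. 88, Proposition 3
p. 87, (1.59) p. 86.  PDF held: `paper:balaban1985-cmp99-regular-spaces-gauge-fixing` (journal page = PDF page + 74).

CITATION HEADER (lean-in-tree rule).  Cell `pub-ymgap` (YM Track A, HUMAN RULING D-0062), DAG node N05 = [B8], seat `pub-ymgap-dag-n05-e`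
(g2; director-ym R141 (C), FAN-OUT §N05 row s3b SUCCESSOR).  WHY.  The re-typed N05 leaf `B8LeafKnitRS.B8LeafRS d L C₂ B₁′ B₀′ B₁ B₂ c₁ inp
B₀β loc fam lan cub toAxial` carries Proposition 6 as the named hypothesis `p6 : B8.Prop6Printed d L B₁ c₁ cub` over an ABSTRACT cube family
`cub : I₄ → B8.CubeData` (n05-a's knit faces `B8LeafKnitZd3E.b8LeafRS_zd3_map_of_thm4` ∕ `b8LeafRS_zd3_map_b9allE`, generic over an index
map `ι : J → ZdIdx d L` with `(ι j).Ω 0 = ℤᵈ`).  Row s3b landed Proposition 6 AT THE CONCRETE CUBE MEMBER (the cube family {□_j} of (1.131)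
as a `ZdIdx` member, n05-c `B8CubeMemberZd`; NODE 00's packaging `Node00.zdCub : ZdIdx d L → B8.CubeData`, node00-def-cube
`Node00.CarriersB8Cube`): `B8Prop6CubeMemberGauged.prop6Printed_zdCub₃` = `B8.Prop6Printed d L (5dLB₀) c₁ (zdCub ∘ f)` for every index
map `f`, MODULO the three Theorem-4 EXISTENCE sockets (`SockHFP₀`∕`SockHFP` = Proposition 5's fixed point, `SockH59` = (1.59)) and the
Prop.-3-frame b9 socket `SockB9P3`, each AT THE CUBE (per-datum `Prop`s at `(η, {□_j}, Λ-tower of □, its bond classes)`).  THIS FILE plugs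
that theorem into the knit: the leaf on `fam₃ ∘ ι` with `cub := zdCub ∘ f`, `B₁ := 5dL·B₀` (print's `B₁ = 5dLB₀`, Prop. 3 p. 87) and the
`p6` binder GONE — in its place the sockets at every cube of every `f j′`, in the SAME currency as the knit's own sockets on the image of `ι`
(`SockHFP₀`, `SockHFP`, the all-levels b9 socket `∀ m ≤ k, SockB9P3 …`; Theorem 4's `SockH59` below `min cB9 (cB9∕K₀)` and Prop. 3's
`SockB9P3` at `cB9` from the all-levels socket by `B8LeafSocketsB9.sockH59_of_allLevels` ∕ `sockB9P3_of_allLevels`).  The remaining printed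
members `p5e p5u p7 t8` stay hypotheses (at `B₁ = 5dLB₀`).

WHAT THIS FILE PROVES (kernel-checked, 0 sorry, theorems only, no `def`).
* §1 `prop6Printed_anti` — `B8.Prop6Printed d L B₁ c₁ fam` is antitone in its threshold `c₁` (a consumer whose layer carries a smaller
  threshold is served a fortiori).
* §2 `prop6Printed_zdCub_b9all₃` — `prop6Printed_zdCub₃` RE-KEYED to the knit's socket currency: per cube `SockHFP₀ cF₀ ∧ SockHFP cF ∧
  (∀ m ≤ k, SockB9P3 cB9 … m …)` ⟹ `B8.Prop6Printed d L (5dLB₀) c₁ (zdCub ∘ f)`, ONE threshold `c₁(d, L, B₀, B₀′, B₀β, C₂, cF₀, cF, cB9, β, len) > 0`.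
* §3 `b8LeafRS_zd3_map_of_thm4_cub₃` — n05-a's socket-free-glue face (`t4 := H4 : B8.Thm4Printed (5dLB₀) (fam₃ ∘ ι)`, Prop. 3's socket `SB9`
  on the image of `ι`) with `p6` DISCHARGED: `∃ c₁ > 0` (chosen before `ι`, `f`), for every `ι` (`Ω₀ = ℤᵈ` on its image), `H4`, `SB9`, every
  cube index map `f` with the three sockets at every cube, and `p5e p5u p7 t8` ⟹ `B8LeafRS d L C₂ (5dLB₀) B₀′ (5dLB₀) B₂ c₁ inp B₀β
  (blockPairNA d Lb 𝔸) (fam₃ ∘ ι) lan (zdCub ∘ f) toAxial`; `b8LeafRS_zd3_map_b9allE_cub₃` — the same on n05-a's socket face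
  (`SockHFP₀`∕`SockHFP`∕`SockP5uE`∕`SB9all` on the image of `ι`).
* §4 `b8LeafRS_zd3_univ_b9allE_cub₃` — the statement of record on the Literature side: `ι := Subtype.val` on `{i ∕∕ i.Ω 0 = univ}` (as
  `B8LeafKnitZd3E.b8LeafRS_zd3_univ_b9allE`) and `f := id` (the cube family of EVERY `ZdIdx` member, `Node00.zdCub`).
* §5 `prop6Printed_cubB8OfRecord_b9all₃` — the `p6` LETTER of any pin face at NODE 00's located layer `lam.withCub` (`cub = cubB8OfRecord θ`):
  `B8.Prop6Printed θ.D θ.L (5·θ.D·θ.L·B₀) c₁′ (cubB8OfRecord θ)` at EVERY `c₁′ ≤ c₁` from the knit-currency sockets at every cube of every member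
  of record (my g0 `prop6Printed_cubB8OfRecord₃` re-keyed + `prop6Printed_anti`), so that a layer with `lam.B₁ = 5·θ.D·θ.L·lam.inp.B₀`,
  `lam.c₁ ≤ c₁` has its `p6` binder discharged whatever sub-family its `t2 t4 p3 p7 t8` slots are keyed to.

HONEST SCOPE.  A knit BY NAME: `p6` is no longer a hypothesis, but NOTHING of Proposition 6's analytic inputs is proved here — Theorem 4's
existence half and Proposition 3 at the cube member enter as the per-cube sockets `SockHFP₀`∕`SockHFP` (Proposition 5 (1.107)–(1.108), whose
typed providers are letters-fed and VACUOUS at finite `Ω₀` until referee flag W8′ is repaired — at a cube member these sockets are UNSUPPLIED,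
not refuted) and `∀ m ≤ k, SockB9P3` ([4] Thm 3.3 in Prop. 3's frame; member-only, per-datum — NOT the family-wide binder refuted by referee
flag J2′); the sockets on the image of `ι` and the printed members `p5e p5u p7 t8` remain hypotheses exactly as in `B8LeafKnitZd3E` (HONEST
SCOPE there and in `B8Prop6CubeMemberGauged` apply verbatim: `GaugedBoundB8`'s (1.136) = sup members, non-strict `≤`, `B₁ = 5dLB₀` with the
tree's `B₀`).  Count-neutral; N05 NOT discharged; one finite `T⁴` programme at fixed `ε`, Bałaban as printed; nothing continuum ∕ ℝ⁴ ∕ OS ∕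
mass-gap ∕ Clay.  No `sorry`, no `def`, no `instance`, no `notation`.  Unit `pub-ymgap-dag-n05-e` (g2), 2026-08-26.
VERSION v1.1 (same seat, APPEND-ONLY §6; + imports `B8LeafKnitZd3LettersRD`, `B8SockHFPCubeMemberRD`; §§1–5 unchanged): THE REPAIRED-LETTERS
CURRENCY AT THE CUBES — `prop6Printed_zdCub_lettersRD₂` ∕ `prop6Printed_cubB8OfRecord_lettersRD₂` (Prop. 6 from EXACTLY TWO object-bound sockets per
cube: n05-d's W8∕W8′-repaired letters socket `SockLettersRD` + the all-levels b9 socket, via n05-c's `sockHFP_pair_cubeMemberRD`) and the knit faces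
`b8LeafRS_zd3_map_lettersRD_cub₂` ∕ `…RDU_cub₂` (n05-d's ι-side letters knits × the cube side in the same currency: `p6` GONE, NO Prop.-5 EXISTENCE
socket left anywhere).  Satisfiability of `SockLettersRD` at a finite-`Ω₀` cube member is the supplier's ∕ referee's question (n05-c's caveat).
-/

noncomputable section

open NormedSpace

namespace Literature.MathematicalPhysics.QuantumFieldTheory.Balaban1983to89.B8LeafKnitZd3Cub

open B7Prop1Explicit B7Prop1Local
open B8Lemma1NonAbelian (blockPairNA)
open B8Eq131CubesAdmissible (cubeFam)
open B8CubeMemberZd (cubeLamS cubeLamB)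
open B8LeafKnitRS (B8LeafRS)
open B8LeafModelZd (SockH59 ZdIdx)
open B8LeafModelZdSockP5uE (SockP5uE)
open B8LeafModelZdOfHFP (SockHFP₀ SockHFP)
open B8LeafModelZd3 (zdGF3 SockB9P3)
open B8LeafSocketsB9 (sockH59_of_allLevels sockB9P3_of_allLevels)
open B8LeafKnitZd3E (b8LeafRS_zd3_map_of_thm4 b8LeafRS_zd3_map_b9allE)
open B8Prop6CubeMemberGauged (prop6Printed_zdCub₃)
open Node00 (CubeB8 zdCub)
open B7Prop2Explicit (unitaryUnits)
open B8SockLettersRD (SockLettersRD)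
open B8SockHFPCubeMemberRD (sockHFP_pair_cubeMemberRD)
open B8LeafKnitZd3LettersRD (b8LeafRS_zd3_map_lettersRD b8LeafRS_zd3_map_lettersRDU)
open B8Ineq132 (InAk covDerivFwd)
open B8Ineq130 (tlo thi)
open B7Eq78Linearization (zdBlocking QprimeIter)
open B8Eq119TwistedAxial (bgT)
open B8Eq140Level (SideTouches)
open B8Eq138LandauZd (covLap QT)
open B8Eq1117Concrete (XSpace)
open B8Prop5ContractionKLevel (Bd2)
open B8LambdaSpaceKLevel (wt)
open QuantumLattice (blockSites)

-- `Site` alone could resolve to the torus sites of `Setup.lean`; re-export the `ℤ^d` sites of `B7Prop1Explicit`.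
export B7Prop1Explicit (Site)

variable {d : ℕ}

/-! ## §1 `B8.Prop6Printed` is antitone in its threshold -/

/-- **`B8.Prop6Printed d L B₁ c₁ fam` IS ANTITONE IN `c₁`** («let 7dL²Mα₀ ≤ c₁», p. 99: a smaller threshold admits fewer data).
[cite: Balaban1985RegularSpaces, Prop. 6 p.99] -/
theorem prop6Printed_anti {I : Type} {n : ℕ} {L B₁ c₁ c₁' : ℝ} (h : c₁' ≤ c₁) {fam : I → B8.CubeData}
    (H : B8.Prop6Printed n L B₁ c₁ fam) : B8.Prop6Printed n L B₁ c₁' fam :=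
  fun i α₀ hα U₀ hU c hc => H i α₀ hα U₀ hU c (hc.trans h)

/-! ## §2 Proposition 6 on `zdCub ∘ f` in the knit's socket currency (`SockHFP₀`, `SockHFP`, all-levels b9) -/

section Cub

variable {𝔸 : Type} [CStarAlgebra 𝔸] [Nontrivial 𝔸]

/-- **`B8.Prop6Printed d L (5dLB₀) c₁ (zdCub ∘ f)` FROM THE KNIT-CURRENCY SOCKETS AT EVERY CUBE** — `B8Prop6CubeMemberGauged.prop6Printed_zdCub₃`
with Theorem 4's (1.59) socket `SockH59` (below `min cB9 (cB9∕K₀)`, `K₀ = 2L·5dLB₀ + 8·8B₀′·5dLB₀`) and Proposition 3's `SockB9P3` (at `cB9`, top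
level) both READ OFF the all-levels b9 socket at the cube (`B8LeafSocketsB9.sockH59_of_allLevels` ∕ `sockB9P3_of_allLevels`): ONE threshold
`c₁ > 0`; for every index map `f` whose cubes carry `SockHFP₀ cF₀`, `SockHFP cF` and `∀ m ≤ k, SockB9P3 cB9 … m …`, Proposition 6's sentence
holds on `zdCub ∘ f` with `B₁ = 5dLB₀`. [cite: Balaban1985RegularSpaces, Prop. 6 (1.135)–(1.138) p.99, Thm 4 p.88 (existence), (1.59) p.86, Prop. 3 p.87] -/
theorem prop6Printed_zdCub_b9all₃ (hd2 : 2 ≤ d) {L : ℕ} (hL : 2 ≤ L) {B₀ B₀' B₀β C₂ cF₀ cF cB9 : ℝ} (hB₀ : 0 < B₀)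
    (hB₀' : 0 < B₀') (hB : 2 ≤ 5 * (d : ℝ) * L * B₀) (hB₀β : 0 ≤ B₀β) (hC₂ : 2097152 * ((d : ℝ) + 1) ^ 2 ≤ C₂)
    (hcF₀ : 0 < cF₀) (hcF : 0 < cF) (hcB9 : 0 < cB9) (β : ℝ) (len : Site d → ℝ) :
    ∃ c₁ : ℝ, 0 < c₁ ∧ ∀ {ι : Type} (f : ι → ZdIdx d L),
      (∀ (j : ι) (c : CubeB8 d L (f j).k (f j).Ω),
        SockHFP₀ (𝔸 := 𝔸) L B₀ B₀' cF₀ (f j).η c.k (cubeFam false L c.a c.M c.ρ c.k) (cubeLamS L c.a c.M c.ρ c.k) ∧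
        SockHFP (𝔸 := 𝔸) L B₀ B₀' cF (f j).η c.k (cubeFam false L c.a c.M c.ρ c.k) (cubeLamS L c.a c.M c.ρ c.k) ∧
        (∀ m, m ≤ c.k → SockB9P3 (𝔸 := 𝔸) L B₀ B₀β cB9 β len (f j).η m (cubeFam false L c.a c.M c.ρ c.k) (cubeLamS L c.a c.M c.ρ c.k)
          (cubeLamB L c.a c.M c.ρ c.k))) →
      B8.Prop6Printed d (L : ℝ) (5 * (d : ℝ) * L * B₀) c₁ (fun j => zdCub 𝔸 L (f j)) := by
  have hd1 : 1 ≤ d := le_trans (by norm_num) hd2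
  have hL1 : 1 ≤ L := le_trans (by norm_num) hL
  -- Theorem 4's (1.59) threshold below the all-levels b9 threshold
  have hK₀ : 0 < 2 * (L * (5 * (d : ℝ) * L * B₀)) + 8 * (8 * B₀' * (5 * (d : ℝ) * L * B₀)) := by positivity
  have hc59 : 0 < min cB9 (cB9 / (2 * (L * (5 * (d : ℝ) * L * B₀)) + 8 * (8 * B₀' * (5 * (d : ℝ) * L * B₀)))) :=
    lt_min hcB9 (div_pos hcB9 hK₀)
  obtain ⟨c₁, hc₁, G⟩ := prop6Printed_zdCub₃ (𝔸 := 𝔸) hd2 hL hB₀ hB₀' hB hB₀β hC₂ hcF₀ hcF hc59 hcB9 β len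
  refine ⟨c₁, hc₁, fun f S => G f fun j c => ?_⟩
  obtain ⟨S₀, S₁, S₉⟩ := S j c
  exact ⟨S₀, S₁, sockH59_of_allLevels hd1 hL1 hB₀ hB₀'.le hcB9 S₉, sockB9P3_of_allLevels S₉⟩

end Cub

/-! ## §3 The knit faces with `p6` discharged at the concrete cube family -/

section Knit

variable {𝔸 : Type} [CStarAlgebra 𝔸] [Nontrivial 𝔸]
variable {I₃ : Type} {lan : I₃ → B8.LandauData}

/-- **THE RE-TYPED B8 LEAF ON `fam₃ ∘ ι` FROM THEOREM 4 AS A HYPOTHESIS, PROPOSITION 6 DISCHARGED AT THE CONCRETE CUBE FAMILY** —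
`B8LeafKnitZd3E.b8LeafRS_zd3_map_of_thm4` with `cub := zdCub ∘ f`, `B₁ := 5dLB₀` and `p6 := prop6Printed_zdCub_b9all₃ …`: ONE threshold `c₁ > 0`
(chosen before `ι` and `f`); hypotheses = `H4` (Theorem 4 on the image of `ι`), Prop. 3's socket `SB9` there, the three sockets at every cube of
every `f j′`, and the printed members `p5e p5u p7 t8` (at `B₁ = 5dLB₀`).
[cite: Balaban1985RegularSpaces, Lemma 1 p.79, Thm 2 p.83, Prop. 3 p.87, Thm 4 p.88, Prop. 6 p.99 (discharged modulo sockets); Prop. 5 p.94, Prop. 7 p.100, Thm 8 p.101 (named hypotheses)] -/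
theorem b8LeafRS_zd3_map_of_thm4_cub₃ (hd2 : 2 ≤ d) {L : ℕ} (hL : 2 ≤ L) (Lb : ℕ) (β : ℝ) (len : Site d → ℝ) (inp : B8.B9Inputs)
    {B₀β C₂ cB9 cF₀ cF B₂ : ℝ} (hB : 2 ≤ 5 * (d : ℝ) * L * inp.B₀) (hB₀β : 0 < B₀β)
    (hC₂ : 2097152 * ((d : ℝ) + 1) ^ 2 ≤ C₂) (hcB9 : 0 < cB9) (hcF₀ : 0 < cF₀) (hcF : 0 < cF) :
    ∃ c₁ : ℝ, 0 < c₁ ∧ ∀ {J : Type} (ι : J → ZdIdx d L), (∀ j, (ι j).Ω 0 = Set.univ) →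
      B8.Thm4Printed (5 * (d : ℝ) * L * inp.B₀) (fun j : J => (zdGF3 𝔸 L β len (ι j)).toGFData) →
      (∀ j : J, SockB9P3 (𝔸 := 𝔸) L inp.B₀ B₀β cB9 β len (ι j).η (ι j).k (ι j).Ω (ι j).Λs (ι j).Λb) →
      ∀ {J' : Type} (f : J' → ZdIdx d L),
      (∀ (j : J') (c : CubeB8 d L (f j).k (f j).Ω),
        SockHFP₀ (𝔸 := 𝔸) L inp.B₀ inp.B₀' cF₀ (f j).η c.k (cubeFam false L c.a c.M c.ρ c.k) (cubeLamS L c.a c.M c.ρ c.k) ∧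
        SockHFP (𝔸 := 𝔸) L inp.B₀ inp.B₀' cF (f j).η c.k (cubeFam false L c.a c.M c.ρ c.k) (cubeLamS L c.a c.M c.ρ c.k) ∧
        (∀ m, m ≤ c.k → SockB9P3 (𝔸 := 𝔸) L inp.B₀ B₀β cB9 β len (f j).η m (cubeFam false L c.a c.M c.ρ c.k)
          (cubeLamS L c.a c.M c.ρ c.k) (cubeLamB L c.a c.M c.ρ c.k))) →
      ∀ {toAxial : ∀ j : J, (zdGF3 𝔸 L β len (ι j)).Cfg → (zdGF3 𝔸 L β len (ι j)).Pert → (zdGF3 𝔸 L β len (ι j)).Pert},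
      B8.Prop5Exists inp.B₀' (5 * (d : ℝ) * L * inp.B₀) lan → B8.Prop5Unique lan →
      B8SectGH.Prop7PrintedR (fun j : J => zdGF3 𝔸 L β len (ι j)) toAxial →
      B8Thm8Surviving.Thm8SurvivingAt 1 (5 * (d : ℝ) * L * inp.B₀) B₂ (fun j : J => zdGF3 𝔸 L β len (ι j)) →
      B8LeafRS d (L : ℝ) C₂ (5 * (d : ℝ) * L * inp.B₀) inp.B₀' (5 * (d : ℝ) * L * inp.B₀) B₂ c₁ inp B₀β (blockPairNA d Lb 𝔸)
        (fun j : J => zdGF3 𝔸 L β len (ι j)) lan (fun j : J' => zdCub 𝔸 L (f j)) toAxial := by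
  obtain ⟨c₁, hc₁, P6⟩ := prop6Printed_zdCub_b9all₃ (𝔸 := 𝔸) hd2 hL inp.B₀_pos inp.B₀'_pos hB hB₀β.le hC₂ hcF₀ hcF hcB9 β len
  refine ⟨c₁, hc₁, fun ι hΩ H4 SB9 _ f S _ p5e p5u p7 t8 => ?_⟩
  exact b8LeafRS_zd3_map_of_thm4 hd2 hL Lb β len inp hB hB₀β hC₂ hcB9 ι hΩ H4 SB9 p5e p5u (P6 f S) p7 t8

/-- **THE RE-TYPED B8 LEAF ON `fam₃ ∘ ι` FROM THE SOCKETS (repaired uniqueness socket, all-levels b9), PROPOSITION 6 DISCHARGED AT THE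
CONCRETE CUBE FAMILY** — `B8LeafKnitZd3E.b8LeafRS_zd3_map_b9allE` with `cub := zdCub ∘ f`, `B₁ := 5dLB₀`, `p6 := prop6Printed_zdCub_b9all₃ …`:
ONE threshold `c₁ > 0` (chosen before `ι` and `f`); hypotheses = the sockets `SockHFP₀`∕`SockHFP`∕`SockP5uE`∕`SB9all` on the image of `ι`
(`Ω₀ = ℤᵈ` there), the sockets `SockHFP₀`∕`SockHFP`∕`SB9all` at every cube of every `f j′`, and the printed members `p5e p5u p7 t8`.
[cite: Balaban1985RegularSpaces, Lemma 1 p.79, Thm 2 p.83, Prop. 3 p.87, Thm 4 p.88, (1.59) p.86, Prop. 6 p.99 (discharged modulo sockets); Prop. 5 p.94, Prop. 7 p.100, Thm 8 p.101 (named hypotheses)] -/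
theorem b8LeafRS_zd3_map_b9allE_cub₃ (hd2 : 2 ≤ d) {L : ℕ} (hL : 2 ≤ L) (Lb : ℕ) (β : ℝ) (len : Site d → ℝ) (inp : B8.B9Inputs)
    {B₀β C₂ cu cF₀ cF cu' cB9 B₂ : ℝ} (hB : 2 ≤ 5 * (d : ℝ) * L * inp.B₀) (hB₀β : 0 < B₀β)
    (hC₂ : 2097152 * ((d : ℝ) + 1) ^ 2 ≤ C₂) (hcu : 0 < cu) (hcF₀ : 0 < cF₀) (hcF : 0 < cF) (hcu' : 0 < cu') (hcB9 : 0 < cB9) :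
    ∃ c₁ : ℝ, 0 < c₁ ∧ ∀ {J : Type} (ι : J → ZdIdx d L), (∀ j, (ι j).Ω 0 = Set.univ) →
      (∀ j : J, SockHFP₀ (𝔸 := 𝔸) L inp.B₀ inp.B₀' cF₀ (ι j).η (ι j).k (ι j).Ω (ι j).Λs) →
      (∀ j : J, SockHFP (𝔸 := 𝔸) L inp.B₀ inp.B₀' cF (ι j).η (ι j).k (ι j).Ω (ι j).Λs) →
      (∀ j : J, SockP5uE (𝔸 := 𝔸) L inp.B₀ cu' cu (ι j).η (ι j).k (ι j).Ω (ι j).Λs) →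
      (∀ j : J, ∀ m, m ≤ (ι j).k → SockB9P3 (𝔸 := 𝔸) L inp.B₀ B₀β cB9 β len (ι j).η m (ι j).Ω (ι j).Λs (ι j).Λb) →
      ∀ {J' : Type} (f : J' → ZdIdx d L),
      (∀ (j : J') (c : CubeB8 d L (f j).k (f j).Ω),
        SockHFP₀ (𝔸 := 𝔸) L inp.B₀ inp.B₀' cF₀ (f j).η c.k (cubeFam false L c.a c.M c.ρ c.k) (cubeLamS L c.a c.M c.ρ c.k) ∧
        SockHFP (𝔸 := 𝔸) L inp.B₀ inp.B₀' cF (f j).η c.k (cubeFam false L c.a c.M c.ρ c.k) (cubeLamS L c.a c.M c.ρ c.k) ∧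
        (∀ m, m ≤ c.k → SockB9P3 (𝔸 := 𝔸) L inp.B₀ B₀β cB9 β len (f j).η m (cubeFam false L c.a c.M c.ρ c.k)
          (cubeLamS L c.a c.M c.ρ c.k) (cubeLamB L c.a c.M c.ρ c.k))) →
      ∀ {toAxial : ∀ j : J, (zdGF3 𝔸 L β len (ι j)).Cfg → (zdGF3 𝔸 L β len (ι j)).Pert → (zdGF3 𝔸 L β len (ι j)).Pert},
      B8.Prop5Exists inp.B₀' (5 * (d : ℝ) * L * inp.B₀) lan → B8.Prop5Unique lan →
      B8SectGH.Prop7PrintedR (fun j : J => zdGF3 𝔸 L β len (ι j)) toAxial →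
      B8Thm8Surviving.Thm8SurvivingAt 1 (5 * (d : ℝ) * L * inp.B₀) B₂ (fun j : J => zdGF3 𝔸 L β len (ι j)) →
      B8LeafRS d (L : ℝ) C₂ (5 * (d : ℝ) * L * inp.B₀) inp.B₀' (5 * (d : ℝ) * L * inp.B₀) B₂ c₁ inp B₀β (blockPairNA d Lb 𝔸)
        (fun j : J => zdGF3 𝔸 L β len (ι j)) lan (fun j : J' => zdCub 𝔸 L (f j)) toAxial := by
  obtain ⟨c₁, hc₁, P6⟩ := prop6Printed_zdCub_b9all₃ (𝔸 := 𝔸) hd2 hL inp.B₀_pos inp.B₀'_pos hB hB₀β.le hC₂ hcF₀ hcF hcB9 β len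
  refine ⟨c₁, hc₁, fun ι hΩ SHFP₀ SHFP SP5u SB9all _ f S _ p5e p5u p7 t8 => ?_⟩
  exact b8LeafRS_zd3_map_b9allE hd2 hL Lb β len inp hB hB₀β hC₂ hcu hcF₀ hcF hcu' hcB9 ι hΩ SHFP₀ SHFP SP5u SB9all p5e p5u (P6 f S) p7 t8

/-! ## §4 The statement of record on the Literature side: `Ω₀ = ℤᵈ` sub-family, the cube family of every member -/

/-- **THE RE-TYPED B8 LEAF ON THE `Ω₀ = ℤᵈ` SUB-FAMILY WITH PROPOSITION 6 DISCHARGED ON THE CUBE FAMILY OF EVERY MEMBER** —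
`b8LeafRS_zd3_map_b9allE_cub₃` at `ι := Subtype.val` on `{i ∕∕ i.Ω 0 = univ}` (n05-a's `b8LeafRS_zd3_univ_b9allE`) and `f := id` (`cub := Node00.zdCub 𝔸 L`,
the cubes of (1.131) inside EVERY `ZdIdx` member): sockets on the sub-family and at every cube, printed members `p5e p5u p7 t8`.
[cite: Balaban1985RegularSpaces, Lemma 1 p.79, Thm 2 p.83, Prop. 3 p.87, Thm 4 p.88, (1.59) p.86, Prop. 6 p.99 (discharged modulo sockets); Prop. 5 p.94, Prop. 7 p.100, Thm 8 p.101 (named hypotheses)] -/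
theorem b8LeafRS_zd3_univ_b9allE_cub₃ (hd2 : 2 ≤ d) {L : ℕ} (hL : 2 ≤ L) (Lb : ℕ) (β : ℝ) (len : Site d → ℝ) (inp : B8.B9Inputs)
    {B₀β C₂ cu cF₀ cF cu' cB9 B₂ : ℝ} (hB : 2 ≤ 5 * (d : ℝ) * L * inp.B₀) (hB₀β : 0 < B₀β)
    (hC₂ : 2097152 * ((d : ℝ) + 1) ^ 2 ≤ C₂) (hcu : 0 < cu) (hcF₀ : 0 < cF₀) (hcF : 0 < cF) (hcu' : 0 < cu') (hcB9 : 0 < cB9) :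
    ∃ c₁ : ℝ, 0 < c₁ ∧
      ((∀ i : {i : ZdIdx d L // i.Ω 0 = Set.univ}, SockHFP₀ (𝔸 := 𝔸) L inp.B₀ inp.B₀' cF₀ i.1.η i.1.k i.1.Ω i.1.Λs) →
      (∀ i : {i : ZdIdx d L // i.Ω 0 = Set.univ}, SockHFP (𝔸 := 𝔸) L inp.B₀ inp.B₀' cF i.1.η i.1.k i.1.Ω i.1.Λs) →
      (∀ i : {i : ZdIdx d L // i.Ω 0 = Set.univ}, SockP5uE (𝔸 := 𝔸) L inp.B₀ cu' cu i.1.η i.1.k i.1.Ω i.1.Λs) →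
      (∀ i : {i : ZdIdx d L // i.Ω 0 = Set.univ}, ∀ m, m ≤ i.1.k →
        SockB9P3 (𝔸 := 𝔸) L inp.B₀ B₀β cB9 β len i.1.η m i.1.Ω i.1.Λs i.1.Λb) →
      (∀ (i : ZdIdx d L) (c : CubeB8 d L i.k i.Ω),
        SockHFP₀ (𝔸 := 𝔸) L inp.B₀ inp.B₀' cF₀ i.η c.k (cubeFam false L c.a c.M c.ρ c.k) (cubeLamS L c.a c.M c.ρ c.k) ∧
        SockHFP (𝔸 := 𝔸) L inp.B₀ inp.B₀' cF i.η c.k (cubeFam false L c.a c.M c.ρ c.k) (cubeLamS L c.a c.M c.ρ c.k) ∧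
        (∀ m, m ≤ c.k → SockB9P3 (𝔸 := 𝔸) L inp.B₀ B₀β cB9 β len i.η m (cubeFam false L c.a c.M c.ρ c.k)
          (cubeLamS L c.a c.M c.ρ c.k) (cubeLamB L c.a c.M c.ρ c.k))) →
      ∀ {toAxial : ∀ i : {i : ZdIdx d L // i.Ω 0 = Set.univ},
          (zdGF3 𝔸 L β len i.1).Cfg → (zdGF3 𝔸 L β len i.1).Pert → (zdGF3 𝔸 L β len i.1).Pert},
      B8.Prop5Exists inp.B₀' (5 * (d : ℝ) * L * inp.B₀) lan → B8.Prop5Unique lan →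
      B8SectGH.Prop7PrintedR (fun i : {i : ZdIdx d L // i.Ω 0 = Set.univ} => zdGF3 𝔸 L β len i.1) toAxial →
      B8Thm8Surviving.Thm8SurvivingAt 1 (5 * (d : ℝ) * L * inp.B₀) B₂ (fun i : {i : ZdIdx d L // i.Ω 0 = Set.univ} => zdGF3 𝔸 L β len i.1) →
      B8LeafRS d (L : ℝ) C₂ (5 * (d : ℝ) * L * inp.B₀) inp.B₀' (5 * (d : ℝ) * L * inp.B₀) B₂ c₁ inp B₀β (blockPairNA d Lb 𝔸)
        (fun i : {i : ZdIdx d L // i.Ω 0 = Set.univ} => zdGF3 𝔸 L β len i.1) lan (fun i : ZdIdx d L => zdCub 𝔸 L i) toAxial) := by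
  obtain ⟨c₁, hc₁, K⟩ := b8LeafRS_zd3_map_b9allE_cub₃ (𝔸 := 𝔸) (lan := lan) hd2 hL Lb β len inp (B₂ := B₂) hB hB₀β hC₂ hcu hcF₀ hcF hcu' hcB9
  refine ⟨c₁, hc₁, fun SHFP₀ SHFP SP5u SB9all S _ p5e p5u p7 t8 => ?_⟩
  exact K Subtype.val (fun i => i.2) SHFP₀ SHFP SP5u SB9all id S p5e p5u p7 t8

end Knit

/-! ## §5 The `p6` letter at NODE 00's member of record `cubB8OfRecord θ`, knit currency, every smaller threshold -/

section Record

/-- **`B8.Prop6Printed` ON NODE 00's MEMBER OF RECORD `Node00.cubB8OfRecord θ` IN THE KNIT'S SOCKET CURRENCY, AT EVERY SMALLER THRESHOLD** —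
the `p6` letter of a pin face at the located layer `lam.withCub` (`Node00.ResidB8.withCub_cub : lam.withCub.cub = cubB8OfRecord θ`,
`Node00.prop6Printed_withCub_iff`) for the Stage-3 parameters of record `θ` (`θ.D ≥ 2`), `B₁ := 5·θ.D·θ.L·B₀`: ONE threshold `c₁ > 0`; from the
sockets `SockHFP₀ cF₀`, `SockHFP cF`, `∀ m ≤ k, SockB9P3 cB9` at every cube of every member of record, Proposition 6's sentence at EVERY `c₁′ ≤ c₁`
(so a layer with `lam.B₁ = 5·θ.D·θ.L·lam.inp.B₀` and `lam.c₁ ≤ c₁` has its `p6` binder discharged) — `prop6Printed_zdCub_b9all₃` at `f := Subtype.val`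
and `prop6Printed_anti`. [cite: Balaban1985RegularSpaces, Prop. 6 (1.135)–(1.138) p.99, Thm 4 p.88 (existence), (1.59) p.86, Prop. 3 p.87] -/
theorem prop6Printed_cubB8OfRecord_b9all₃ (θ : Node00.Stage3Params) (hD : 2 ≤ θ.D) {B₀ B₀' B₀β C₂ cF₀ cF cB9 : ℝ} (hB₀ : 0 < B₀)
    (hB₀' : 0 < B₀') (hB : 2 ≤ 5 * (θ.D : ℝ) * θ.L * B₀) (hB₀β : 0 ≤ B₀β) (hC₂ : 2097152 * ((θ.D : ℝ) + 1) ^ 2 ≤ C₂)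
    (hcF₀ : 0 < cF₀) (hcF : 0 < cF) (hcB9 : 0 < cB9) (β : ℝ) (len : Site θ.D → ℝ) :
    ∃ c₁ : ℝ, 0 < c₁ ∧
      ((∀ (i : Node00.IdxB8 θ) (c : CubeB8 θ.D θ.L i.1.k i.1.Ω),
        SockHFP₀ (𝔸 := θ.𝔸) θ.L B₀ B₀' cF₀ i.1.η c.k (cubeFam false θ.L c.a c.M c.ρ c.k) (cubeLamS θ.L c.a c.M c.ρ c.k) ∧
        SockHFP (𝔸 := θ.𝔸) θ.L B₀ B₀' cF i.1.η c.k (cubeFam false θ.L c.a c.M c.ρ c.k) (cubeLamS θ.L c.a c.M c.ρ c.k) ∧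
        (∀ m, m ≤ c.k → SockB9P3 (𝔸 := θ.𝔸) θ.L B₀ B₀β cB9 β len i.1.η m (cubeFam false θ.L c.a c.M c.ρ c.k)
          (cubeLamS θ.L c.a c.M c.ρ c.k) (cubeLamB θ.L c.a c.M c.ρ c.k))) →
      ∀ c₁', c₁' ≤ c₁ → B8.Prop6Printed θ.D (θ.L : ℝ) (5 * (θ.D : ℝ) * θ.L * B₀) c₁' (Node00.cubB8OfRecord θ)) := by
  obtain ⟨c₁, hc₁, G⟩ := prop6Printed_zdCub_b9all₃ (𝔸 := θ.𝔸) hD θ.two_le_L hB₀ hB₀' hB hB₀β hC₂ hcF₀ hcF hcB9 β len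
  exact ⟨c₁, hc₁, fun S c₁' hc => prop6Printed_anti hc (G (fun i : Node00.IdxB8 θ => i.1) S)⟩

end Record

/-! ## §6 (v1.1) The repaired-letters currency at the cubes: two object-bound sockets per cube, no Proposition-5 existence socket anywhere -/

section LettersRD

variable {𝔸 : Type} [CStarAlgebra 𝔸] [Nontrivial 𝔸]

/-- **`B8.Prop6Printed d L (5dLB₀) c₁ (zdCub ∘ f)` FROM EXACTLY TWO OBJECT-BOUND SOCKETS PER CUBE** — the W8∕W8′-repaired [4]-letters socket
`SockLettersRD` (threshold `c_L`; laws on print's domains, n05-d `B8SockLettersRD`) and the all-levels b9 socket (`∀ m ≤ k, SockB9P3 cB9`):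
`prop6Printed_zdCub_b9all₃` with the Prop.-5 existence sockets `SockHFP₀`∕`SockHFP` at every cube SUPPLIED by n05-c's
`B8SockHFPCubeMemberRD.sockHFP_pair_cubeMemberRD` (n05-d's `exists_threshold_sockHFP_pairRD` with the cube member's six laws discharged).  ONE
threshold `c₁(d, L, B₀, B₀′, B₀′_H, B₂′, B_G, B_R, B₀β, C₂, c_{B9}, c_L, β, len) > 0`, under the letters' free-constant window `3·(2dL²)·B_G·B_R ≤ B₀′`.
[cite: Balaban1985RegularSpaces, Prop. 6 (1.135)–(1.138) p.99, Prop. 5 (1.106)–(1.108) p.94, (1.59) p.86, Prop. 3 p.87; Balaban1985BackgroundPropagators, Thm 3.1 p.397, Thm 3.3 p.398] -/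
theorem prop6Printed_zdCub_lettersRD₂ (hd2 : 2 ≤ d) {L : ℕ} (hL : 2 ≤ L) {B₀ B₀' B₀'H B₂' BG BR B₀β C₂ cB9 cL : ℝ} (hB₀ : 0 < B₀)
    (hB₀' : 0 < B₀') (hB : 2 ≤ 5 * (d : ℝ) * L * B₀) (hB₀'H : 0 < B₀'H) (hB₂' : 0 ≤ B₂') (hBG : 0 ≤ BG) (hBR : 0 ≤ BR)
    (hB₀β : 0 ≤ B₀β) (hC₂ : 2097152 * ((d : ℝ) + 1) ^ 2 ≤ C₂) (hcB9 : 0 < cB9) (hcL : 0 < cL)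
    (hfree : 3 * (2 * (d : ℝ) * (L : ℝ) ^ 2) * BG * BR ≤ B₀') (β : ℝ) (len : Site d → ℝ) :
    ∃ c₁ : ℝ, 0 < c₁ ∧ ∀ {ι : Type} (f : ι → ZdIdx d L),
      (∀ (j : ι) (c : CubeB8 d L (f j).k (f j).Ω),
        SockLettersRD (𝔸 := 𝔸) L BG BR B₀'H B₂' cL (f j).η c.k (cubeFam false L c.a c.M c.ρ c.k) (cubeLamS L c.a c.M c.ρ c.k) ∧
        (∀ m, m ≤ c.k → SockB9P3 (𝔸 := 𝔸) L B₀ B₀β cB9 β len (f j).η m (cubeFam false L c.a c.M c.ρ c.k) (cubeLamS L c.a c.M c.ρ c.k)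
          (cubeLamB L c.a c.M c.ρ c.k))) →
      B8.Prop6Printed d (L : ℝ) (5 * (d : ℝ) * L * B₀) c₁ (fun j => zdCub 𝔸 L (f j)) := by
  obtain ⟨cF, hcF, HF⟩ := sockHFP_pair_cubeMemberRD (𝔸 := 𝔸) hd2 hL hB₀ hB₀' hB hB₀'H hB₂' hBG hBR hcB9 hcL hfree
  obtain ⟨c₁, hc₁, G⟩ := prop6Printed_zdCub_b9all₃ (𝔸 := 𝔸) hd2 hL hB₀ hB₀' hB hB₀β hC₂ hcF hcF hcB9 β len
  refine ⟨c₁, hc₁, fun f S => G f fun j c => ?_⟩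
  obtain ⟨SLet, S₉⟩ := S j c
  obtain ⟨S₀, S₁⟩ := HF (f j).hη c.one_le_k c.a c.M c.L_le_ρ SLet S₉
  exact ⟨S₀, S₁, S₉⟩

/-- **`B8.Prop6Printed` ON NODE 00's MEMBER OF RECORD `cubB8OfRecord θ` FROM TWO OBJECT-BOUND SOCKETS PER CUBE, AT EVERY SMALLER THRESHOLD** —
the `p6` letter of a pin face at the located layer `lam.withCub` in the repaired-letters currency: `prop6Printed_zdCub_lettersRD₂` at
`f := Subtype.val` and `prop6Printed_anti`. [cite: Balaban1985RegularSpaces, Prop. 6 (1.135)–(1.138) p.99, Prop. 5 p.94, (1.59) p.86; Balaban1985BackgroundPropagators, Thm 3.1 p.397, Thm 3.3 p.398] -/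
theorem prop6Printed_cubB8OfRecord_lettersRD₂ (θ : Node00.Stage3Params) (hD : 2 ≤ θ.D) {B₀ B₀' B₀'H B₂' BG BR B₀β C₂ cB9 cL : ℝ}
    (hB₀ : 0 < B₀) (hB₀' : 0 < B₀') (hB : 2 ≤ 5 * (θ.D : ℝ) * θ.L * B₀) (hB₀'H : 0 < B₀'H) (hB₂' : 0 ≤ B₂') (hBG : 0 ≤ BG) (hBR : 0 ≤ BR)
    (hB₀β : 0 ≤ B₀β) (hC₂ : 2097152 * ((θ.D : ℝ) + 1) ^ 2 ≤ C₂) (hcB9 : 0 < cB9) (hcL : 0 < cL)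
    (hfree : 3 * (2 * (θ.D : ℝ) * (θ.L : ℝ) ^ 2) * BG * BR ≤ B₀') (β : ℝ) (len : Site θ.D → ℝ) :
    ∃ c₁ : ℝ, 0 < c₁ ∧
      ((∀ (i : Node00.IdxB8 θ) (c : CubeB8 θ.D θ.L i.1.k i.1.Ω),
        SockLettersRD (𝔸 := θ.𝔸) θ.L BG BR B₀'H B₂' cL i.1.η c.k (cubeFam false θ.L c.a c.M c.ρ c.k) (cubeLamS θ.L c.a c.M c.ρ c.k) ∧
        (∀ m, m ≤ c.k → SockB9P3 (𝔸 := θ.𝔸) θ.L B₀ B₀β cB9 β len i.1.η m (cubeFam false θ.L c.a c.M c.ρ c.k)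
          (cubeLamS θ.L c.a c.M c.ρ c.k) (cubeLamB θ.L c.a c.M c.ρ c.k))) →
      ∀ c₁', c₁' ≤ c₁ → B8.Prop6Printed θ.D (θ.L : ℝ) (5 * (θ.D : ℝ) * θ.L * B₀) c₁' (Node00.cubB8OfRecord θ)) := by
  obtain ⟨c₁, hc₁, G⟩ := prop6Printed_zdCub_lettersRD₂ (𝔸 := θ.𝔸) hD θ.two_le_L hB₀ hB₀' hB hB₀'H hB₂' hBG hBR hB₀β hC₂ hcB9 hcL hfree β len
  exact ⟨c₁, hc₁, fun S c₁' hc => prop6Printed_anti hc (G (fun i : Node00.IdxB8 θ => i.1) S)⟩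

variable {I₃ : Type} {lan : I₃ → B8.LandauData}

/-- **THE N05 LEAF ON `fam₃ ∘ ι`, LETTERS ON PRINT'S DOMAINS ON BOTH SIDES, PROPOSITION 6 DISCHARGED AT THE CUBES** — n05-d's
`B8LeafKnitZd3LettersRD.b8LeafRS_zd3_map_lettersRD` (ι-side: `SockLettersRD`, `SockP5uE`, `SB9all`, the member laws (L1)∕(L2), `Ω₀ = ℤᵈ`) with
`cub := zdCub ∘ f`, `B₁ := 5dLB₀` and `p6 := prop6Printed_zdCub_lettersRD₂ …` (cube side: `SockLettersRD` + `SB9all` at every cube): ONE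
threshold `c₁ > 0` chosen before `ι` and `f`; NO Proposition-5 EXISTENCE socket left anywhere; printed members still hypotheses `p5e p5u p7 t8`.
[cite: Balaban1985RegularSpaces, Lemma 1 p.79, Thm 2 p.83, Prop. 3 p.87, Thm 4 p.88, Prop. 5 (1.106)–(1.108) p.94, (1.59) p.86, Prop. 6 p.99 (discharged modulo sockets); Prop. 5 (1.109) p.94, Prop. 7 p.100, Thm 8 p.101 (named hypotheses); Balaban1985BackgroundPropagators, Thms 3.1–3.3 pp.397–398] -/
theorem b8LeafRS_zd3_map_lettersRD_cub₂ (hd2 : 2 ≤ d) {L : ℕ} (hL : 2 ≤ L) (Lb : ℕ) (β : ℝ) (len : Site d → ℝ) (inp : B8.B9Inputs)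
    {B₀β C₂ cu cu' cB9 B₂ B₀'H B₂' BG BR cL : ℝ} (hB : 2 ≤ 5 * (d : ℝ) * L * inp.B₀) (hB₀β : 0 < B₀β)
    (hC₂ : 2097152 * ((d : ℝ) + 1) ^ 2 ≤ C₂) (hcu : 0 < cu) (hcu' : 0 < cu') (hcB9 : 0 < cB9)
    (hB₀'H : 0 < B₀'H) (hB₂' : 0 ≤ B₂') (hBG : 0 ≤ BG) (hBR : 0 ≤ BR) (hcL : 0 < cL)
    (hfree : 3 * (2 * (d : ℝ) * (L : ℝ) ^ 2) * BG * BR ≤ inp.B₀') :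
    ∃ c₁ : ℝ, 0 < c₁ ∧ ∀ {J : Type} (ι : J → ZdIdx d L), (∀ j, (ι j).Ω 0 = Set.univ) →
      (∀ j : J, ∀ m, m ≤ (ι j).k → ∀ n, n ≤ m → ∀ y ∈ (ι j).Λs m n, ∀ x, InBox (tlo L y n) (thi L y n) x → x ∈ (ι j).Ω n) →
      (∀ j : J, ∀ m, m < (ι j).k → ∀ n, n < m → (ι j).Λs m n = (ι j).Λs (m + 1) n) →
      (∀ j : J, ∀ m, m < (ι j).k → ∀ x, x ∈ (ι j).Λs m m ↔ x ∈ (ι j).Λs (m + 1) m ∨ ∃ y ∈ (ι j).Λs (m + 1) (m + 1), x ∈ blockSites L y) →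
      (∀ j : J, SockLettersRD (𝔸 := 𝔸) L BG BR B₀'H B₂' cL (ι j).η (ι j).k (ι j).Ω (ι j).Λs) →
      (∀ j : J, SockP5uE (𝔸 := 𝔸) L inp.B₀ cu' cu (ι j).η (ι j).k (ι j).Ω (ι j).Λs) →
      (∀ j : J, ∀ m, m ≤ (ι j).k → SockB9P3 (𝔸 := 𝔸) L inp.B₀ B₀β cB9 β len (ι j).η m (ι j).Ω (ι j).Λs (ι j).Λb) →
      ∀ {J' : Type} (f : J' → ZdIdx d L),
      (∀ (j : J') (c : CubeB8 d L (f j).k (f j).Ω),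
        SockLettersRD (𝔸 := 𝔸) L BG BR B₀'H B₂' cL (f j).η c.k (cubeFam false L c.a c.M c.ρ c.k) (cubeLamS L c.a c.M c.ρ c.k) ∧
        (∀ m, m ≤ c.k → SockB9P3 (𝔸 := 𝔸) L inp.B₀ B₀β cB9 β len (f j).η m (cubeFam false L c.a c.M c.ρ c.k)
          (cubeLamS L c.a c.M c.ρ c.k) (cubeLamB L c.a c.M c.ρ c.k))) →
      ∀ {toAxial : ∀ j : J, (zdGF3 𝔸 L β len (ι j)).Cfg → (zdGF3 𝔸 L β len (ι j)).Pert → (zdGF3 𝔸 L β len (ι j)).Pert},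
      B8.Prop5Exists inp.B₀' (5 * (d : ℝ) * L * inp.B₀) lan → B8.Prop5Unique lan →
      B8SectGH.Prop7PrintedR (fun j : J => zdGF3 𝔸 L β len (ι j)) toAxial →
      B8Thm8Surviving.Thm8SurvivingAt 1 (5 * (d : ℝ) * L * inp.B₀) B₂ (fun j : J => zdGF3 𝔸 L β len (ι j)) →
      B8LeafRS d (L : ℝ) C₂ (5 * (d : ℝ) * L * inp.B₀) inp.B₀' (5 * (d : ℝ) * L * inp.B₀) B₂ c₁ inp B₀β (blockPairNA d Lb 𝔸)
        (fun j : J => zdGF3 𝔸 L β len (ι j)) lan (fun j : J' => zdCub 𝔸 L (f j)) toAxial := by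
  obtain ⟨c₁, hc₁, P6⟩ := prop6Printed_zdCub_lettersRD₂ (𝔸 := 𝔸) hd2 hL inp.B₀_pos inp.B₀'_pos hB hB₀'H hB₂' hBG hBR hB₀β.le hC₂ hcB9
    hcL hfree β len
  refine ⟨c₁, hc₁, fun ι hΩ hL1 hL2lt hL2top SLet SP5u SB9all _ f S _ p5e p5u p7 t8 => ?_⟩
  exact b8LeafRS_zd3_map_lettersRD hd2 hL Lb β len inp hB hB₀β hC₂ hcu hcu' hcB9 hB₀'H hB₂' hBG hBR hcL hfree ι hΩ hL1 hL2lt hL2top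
    SLet SP5u SB9all p5e p5u (P6 f S) p7 t8

/-- **THE N05 LEAF ON `fam₃ ∘ ι` WITH NO PROPOSITION-5 SOCKET LEFT AND PROPOSITION 6 DISCHARGED AT THE CUBES** — n05-d's
`B8LeafKnitZd3LettersRD.b8LeafRS_zd3_map_lettersRDU` (ι-side: `SockLettersRD`, n04-b's twelve-law UNIQUENESS letters `SLetU` feeding
`exists_threshold_sockP5uE`, `SB9all`, the member laws (L1)∕(L2), `Ω₀ = ℤᵈ`) with `cub := zdCub ∘ f`, `B₁ := 5dLB₀` and
`p6 := prop6Printed_zdCub_lettersRD₂ …` (cube side: `SockLettersRD` + `SB9all` at every cube).  Remaining hypotheses: [4]'s letters (existence side on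
ι and on the cubes, uniqueness side on ι), the b9 socket (on ι and on the cubes), the member laws, the free-constant window, and `p5e p5u p7 t8`.
[cite: Balaban1985RegularSpaces, Lemma 1 p.79, Thm 2 p.83, Prop. 3 p.87, Thm 4 p.88, Prop. 5 (1.106)–(1.109) p.94, (1.59) p.86, Prop. 6 p.99 (discharged modulo sockets); Prop. 7 p.100, Thm 8 p.101 (named hypotheses); Balaban1985BackgroundPropagators, Thms 3.1–3.3 pp.397–398, (3.25) p.394] -/
theorem b8LeafRS_zd3_map_lettersRDU_cub₂ (hd2 : 2 ≤ d) {L : ℕ} (hL : 2 ≤ L) (Lb : ℕ) (β : ℝ) (len : Site d → ℝ) (inp : B8.B9Inputs)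
    {B₀β C₂ cB9 B₂ B₀'H B₂' BG BR cL : ℝ} (hB : 2 ≤ 5 * (d : ℝ) * L * inp.B₀) (hB₀β : 0 < B₀β)
    (hC₂ : 2097152 * ((d : ℝ) + 1) ^ 2 ≤ C₂) (hcB9 : 0 < cB9)
    (hB₀'H : 0 < B₀'H) (hB₂' : 0 ≤ B₂') (hBG : 0 ≤ BG) (hBR : 0 ≤ BR) (hcL : 0 < cL)
    (hfree : 3 * (2 * (d : ℝ) * (L : ℝ) ^ 2) * BG * BR ≤ inp.B₀') :
    ∃ c₁ : ℝ, 0 < c₁ ∧ ∀ {J : Type} (ι : J → ZdIdx d L), (∀ j, (ι j).Ω 0 = Set.univ) →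
      (∀ j : J, ∀ m, m ≤ (ι j).k → ∀ n, n ≤ m → ∀ y ∈ (ι j).Λs m n, ∀ x, InBox (tlo L y n) (thi L y n) x → x ∈ (ι j).Ω n) →
      (∀ j : J, ∀ m, m < (ι j).k → ∀ n, n < m → (ι j).Λs m n = (ι j).Λs (m + 1) n) →
      (∀ j : J, ∀ m, m < (ι j).k → ∀ x, x ∈ (ι j).Λs m m ↔ x ∈ (ι j).Λs (m + 1) m ∨ ∃ y ∈ (ι j).Λs (m + 1) (m + 1), x ∈ blockSites L y) →
      (∀ j : J, SockLettersRD (𝔸 := 𝔸) L BG BR B₀'H B₂' cL (ι j).η (ι j).k (ι j).Ω (ι j).Λs) →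
      (∀ j : J, ∀ α₀ : ℝ, 0 < α₀ → α₀ ≤ cL → ∀ U₀ : Site d → Fin d → 𝔸ˣ, (∀ x κ, U₀ x κ ∈ unitaryUnits 𝔸) →
        InAk L (ι j).k (ι j).η α₀ (ι j).Ω U₀ →
        ∃ (g Δ : (Site d → 𝔸) →ₗ[ℂ] (Site d → 𝔸)) (q : (Site d → 𝔸) →ₗ[ℂ] (ℕ → Site d → 𝔸)) (qs : (ℕ → Site d → 𝔸) →ₗ[ℂ] (Site d → 𝔸))
          (Aw c : (ℕ → Site d → 𝔸) →ₗ[ℂ] (ℕ → Site d → 𝔸)) (H' : XSpace d (ι j).k 𝔸 →ₗ[ℂ] (Site d → 𝔸)),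
          (∀ x, g (Δ x + qs (Aw (q x))) = x) ∧ (∀ φ, qs (c (q (g (g (qs φ))))) = qs φ) ∧
          (∀ (f : Site d → 𝔸), ∀ x ∈ (ι j).Ω 0, Δ f x = covLap (ι j).η U₀ (((ι j).Ω 0).indicator f) x) ∧
          (∀ (μ : ℕ → Site d → 𝔸), ∀ x ∈ (ι j).Ω 0, qs μ x = QT L (ι j).k ((ι j).Λs (ι j).k) U₀ μ x) ∧
          (∀ (f : Site d → 𝔸) (n : ℕ), n ≤ (ι j).k → ∀ y ∈ (ι j).Λs (ι j).k n, q f n y = QprimeIter (zdBlocking d L) (bgT L U₀) n f y) ∧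
          (∀ (f : Site d → 𝔸) (n : ℕ) (y : Site d), ¬ (n ≤ (ι j).k ∧ y ∈ (ι j).Λs (ι j).k n) → q f n y = 0) ∧
          (∀ (X : XSpace d (ι j).k 𝔸) (x : Site d), ‖H' X x‖ ≤ B₀'H * ‖X‖) ∧
          (∀ n, n ≤ (ι j).k → ∀ (X : XSpace d (ι j).k 𝔸), ∀ p ∈ {b : Site d × Fin d | SideTouches ((ι j).Ω n) b.1 b.2},
            wt L (ι j).η n * ‖covDerivFwd (ι j).η U₀ p.2 (H' X) p.1‖ ≤ B₀'H * ‖X‖) ∧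
          (∀ X : XSpace d (ι j).k 𝔸, Bd2 L (ι j).η (ι j).k (ι j).Ω (covLap (ι j).η U₀ (H' X)) (B₂' * ‖X‖)) ∧
          (∀ (Y : XSpace d (ι j).k 𝔸) (n : ℕ) (hn : n ≤ (ι j).k) (y : Site d), y ∈ (ι j).Λs (ι j).k n →
            QprimeIter (zdBlocking d L) (bgT L U₀) n (H' Y) y = Y (⟨n, Nat.lt_succ_of_le hn⟩, y)) ∧
          (∀ (f : Site d → 𝔸) (r : ℝ), 0 ≤ r → Bd2 L (ι j).η (ι j).k (ι j).Ω f r →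
            (∀ x, ‖g f x‖ ≤ BG * r) ∧ ∀ n, n ≤ (ι j).k → ∀ p ∈ {b : Site d × Fin d | SideTouches ((ι j).Ω n) b.1 b.2},
              wt L (ι j).η n * ‖covDerivFwd (ι j).η U₀ p.2 (g f) p.1‖ ≤ BG * r) ∧
          (∀ (f : Site d → 𝔸) (r : ℝ), 0 ≤ r → Bd2 L (ι j).η (ι j).k (ι j).Ω f r →
            Bd2 L (ι j).η (ι j).k (ι j).Ω (f - g (qs (c (q (g f))))) (BR * r))) →
      (∀ j : J, ∀ m, m ≤ (ι j).k → SockB9P3 (𝔸 := 𝔸) L inp.B₀ B₀β cB9 β len (ι j).η m (ι j).Ω (ι j).Λs (ι j).Λb) →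
      ∀ {J' : Type} (f : J' → ZdIdx d L),
      (∀ (j : J') (c : CubeB8 d L (f j).k (f j).Ω),
        SockLettersRD (𝔸 := 𝔸) L BG BR B₀'H B₂' cL (f j).η c.k (cubeFam false L c.a c.M c.ρ c.k) (cubeLamS L c.a c.M c.ρ c.k) ∧
        (∀ m, m ≤ c.k → SockB9P3 (𝔸 := 𝔸) L inp.B₀ B₀β cB9 β len (f j).η m (cubeFam false L c.a c.M c.ρ c.k)
          (cubeLamS L c.a c.M c.ρ c.k) (cubeLamB L c.a c.M c.ρ c.k))) →
      ∀ {toAxial : ∀ j : J, (zdGF3 𝔸 L β len (ι j)).Cfg → (zdGF3 𝔸 L β len (ι j)).Pert → (zdGF3 𝔸 L β len (ι j)).Pert},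
      B8.Prop5Exists inp.B₀' (5 * (d : ℝ) * L * inp.B₀) lan → B8.Prop5Unique lan →
      B8SectGH.Prop7PrintedR (fun j : J => zdGF3 𝔸 L β len (ι j)) toAxial →
      B8Thm8Surviving.Thm8SurvivingAt 1 (5 * (d : ℝ) * L * inp.B₀) B₂ (fun j : J => zdGF3 𝔸 L β len (ι j)) →
      B8LeafRS d (L : ℝ) C₂ (5 * (d : ℝ) * L * inp.B₀) inp.B₀' (5 * (d : ℝ) * L * inp.B₀) B₂ c₁ inp B₀β (blockPairNA d Lb 𝔸)
        (fun j : J => zdGF3 𝔸 L β len (ι j)) lan (fun j : J' => zdCub 𝔸 L (f j)) toAxial := by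
  obtain ⟨c₁, hc₁, P6⟩ := prop6Printed_zdCub_lettersRD₂ (𝔸 := 𝔸) hd2 hL inp.B₀_pos inp.B₀'_pos hB hB₀'H hB₂' hBG hBR hB₀β.le hC₂ hcB9
    hcL hfree β len
  refine ⟨c₁, hc₁, fun ι hΩ hL1 hL2lt hL2top SLet SLetU SB9all _ f S _ p5e p5u p7 t8 => ?_⟩
  exact b8LeafRS_zd3_map_lettersRDU hd2 hL Lb β len inp hB hB₀β hC₂ hcB9 hB₀'H hB₂' hBG hBR hcL hfree ι hΩ hL1 hL2lt hL2top
    SLet SLetU SB9all p5e p5u (P6 f S) p7 t8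

end LettersRD

end Literature.MathematicalPhysics.QuantumFieldTheory.Balaban1983to89.B8LeafKnitZd3Cub

end
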